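import Summits.AtomisticToContinuum.BoseEinsteinCondensation.Theorems.BECInsertionCorrectorStaticResponseToHMinusOneEnvelope
import Summits.AtomisticToContinuum.BoseEinsteinCondensation.Theorems.BECInsertionCorrectorStaticResponseToHMinusOneEulerLagrange
import Summits.AtomisticToContinuum.BoseEinsteinCondensation.Theorems.BECInsertionCorrectorCorrectorClosureResponseDictionarySymm

/-!
# Route `BECInsertionCorrector`, support item `StaticResponseToHMinusOne`
# (stmt-AtomisticToContinuum-12060) — V: the energy → `H₋₁` dictionary (Kipnis–Varadhan bridge)

`staticResponseToHMinusOne_proof : StaticResponseToHMinusOne`. On a torus of side `L > 0`, let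
`Θ ≥ 0` be a periodic trial state attaining the periodic ground-state energy `E₀ < ∞` and assume
the energy-currency response bound `E₀ − C t² ≤ ⟨Ψ,HΨ⟩ + t ∫ g|Ψ|²` for all `t` and all
finite-energy periodic `Ψ`, `g = ∑ⱼ cos(p·xⱼ)`. Then `‖g‖²_{H₋₁(|Θ|² dX)} ≤ C`, i.e.
`2∫ g φ Θ² − ∫|∇φ|²Θ² ≤ C` for every periodic `C¹` test function `φ` (Kipnis–Landim's variational
formula (6.1)).

Proof. (part I) replace the possibly non-measurable interaction by a measurable weight `W` with
the same energies; by concavity and permutation invariance it suffices to treat SYMMETRIC `φ`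
(`hMinusOneSqW_le_of_symmetric_tests` of the sibling file `…CorrectorClosureResponseDictionarySymm`);
(II–III) insert the admissible states `Ψ_s = c_s(1 + sφ)Θ`: by the ground-state
representation `⟨Ψ_s,HΨ_s⟩ = E₀ + c_s² s² 𝓔_Θ(φ,φ)`, while `∫ g|Ψ_s|² = c_s²(2s∫gφΘ² + s²∫gφ²Θ²)`
because `∫ gΘ² = 0` (the hypothesis at `Ψ = Θ`, first order in `t`); the hypothesis at
`(t, Ψ) = (−s, Ψ_s)` divided by `s² > 0` gives `0 ≤ 𝓔(φ) − 2∫gφΘ² − s∫gφ²Θ² + C/c_s²`, and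
`s → 0` (`c_s → 1`) yields the claim.

References: [KipnisVaradhan1986] (1.14), Thm 1.8; [KipnisLandim1999] App. 1 §6 (6.1);
[Davies1989] §4.2; [LSSY2005] Ch. 2.
-/

noncomputable section

open MeasureTheory Filter Set Metric
open scoped ENNReal NNReal Topology BigOperators

namespace Summit.AtomisticToContinuum.BoseEinsteinCondensation.Theorems

open Literature.MathematicalPhysics.QuantumManyBody.BoseGas
open Summit.AtomisticToContinuum.BoseEinsteinCondensation.Theorems.StaticResponseToHMinusOne
open Summit.AtomisticToContinuum.BoseEinsteinCondensation.Cruxes.StaticResponseBound.UvThomsonForceWave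
  (integral_mul_perturb_sq eq_zero_of_forall_small_quadratic_nonneg)
open Summit.AtomisticToContinuum.BoseEinsteinCondensation.Theorems.StaticResponseBound.Negative
  (integral_norm_sq_eq_one)
open Summit.AtomisticToContinuum.BoseEinsteinCondensation.Theorems.CorrectorClosure.HealingScaleKacInsertion.ResponseDictionary
  (hMinusOneSqW_le_of_symmetric_tests)

/-- **The energy → `H₋₁` dictionary** (route `BECInsertionCorrector`, item
stmt-AtomisticToContinuum-12060): for a nonnegative periodic minimiser `Θ` of finite energy, the
static response bound `E₀ − Ct² ≤ ⟨Ψ,HΨ⟩ + t∫(∑ⱼcos(p·xⱼ))|Ψ|²` (all `t`, all finite-energy periodic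
`Ψ`) implies the Kipnis–Varadhan bound `‖∑ⱼcos(p·xⱼ)‖²_{H₋₁(|Θ|²)} ≤ C`.
[cite: KipnisLandim1999, App. 1 §6 (6.1)] -/
theorem staticResponseToHMinusOne_proof :
    Summit.AtomisticToContinuum.BoseEinsteinCondensation.Theses.BECInsertionCorrector.StaticResponseToHMinusOne := by
  unfold Summit.AtomisticToContinuum.BoseEinsteinCondensation.Theses.BECInsertionCorrector.StaticResponseToHMinusOne
  intro v N L C _hL _hC k Θ hreal hE0 hfin hresp
  -- the observable `g = ∑ⱼ cos(p·xⱼ)` as an opaque function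
  obtain ⟨g, hg⟩ : ∃ g : Config N → ℝ,
      g = fun X => ∑ j, Real.cos (2 * Real.pi / L * ∑ i, (k i : ℝ) * X j i) := ⟨_, rfl⟩
  have hgX : ∀ X : Config N, (∑ j, Real.cos (2 * Real.pi / L * ∑ i, (k i : ℝ) * X j i)) = g X :=
    fun X => by rw [hg]
  simp only [hgX] at hresp ⊢
  -- part I: a measurable weight computing all energies
  obtain ⟨W, hW, -, -, hEW⟩ := exists_measurable_weight v N L
  -- minimality of `Θ`
  have hmin : ∀ Ψ : PeriodicTrialState N L, periodicEnergy v Θ ≤ periodicEnergy v Ψ :=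
    fun Ψ => hE0 ▸ periodicGroundStateEnergy_le v Ψ
  have hE0r : (periodicGroundStateEnergy v N L).toReal = (periodicEnergy v Θ).toReal := by
    rw [hE0]
  -- continuity and symmetry of the data
  have hgc : Continuous g := by rw [hg]; fun_prop
  have hgsymm : ∀ (σ : Equiv.Perm (Fin N)) (X : Config N), g (X ∘ σ) = g X := by
    intro σ X
    rw [hg]
    exact Equiv.sum_comp σ (fun j => Real.cos (2 * Real.pi / L * ∑ i, (k i : ℝ) * X j i))
  have hFc : Continuous fun X => ‖Θ.ψ X‖ := Θ.contDiff.continuous.norm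
  have hFsymm : ∀ (σ : Equiv.Perm (Fin N)) (X : Config N), ‖Θ.ψ (X ∘ σ)‖ = ‖Θ.ψ X‖ :=
    fun σ X => by rw [Θ.symm σ X]
  -- first order at `Ψ = Θ`: the observable is centred, `∫ g Θ² = 0`
  have hmean : ∫ X in cellN N L, g X * ‖Θ.ψ X‖ ^ 2 = 0 := by
    have hq : ∀ t : ℝ, |t| < 1 →
        0 ≤ 2 * t * ((∫ X in cellN N L, g X * ‖Θ.ψ X‖ ^ 2) / 2) + t ^ 2 * C := by
      intro t _
      have h := hresp t Θ hfin
      rw [hE0r] at h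
      nlinarith [h]
    have h := eq_zero_of_forall_small_quadratic_nonneg one_pos hq
    linarith
  -- the bound for SYMMETRIC test functions
  have hmainS : ∀ φ : Config N → ℝ, IsPeriodicTest L φ →
      (∀ (σ : Equiv.Perm (Fin N)) (X : Config N), φ (X ∘ σ) = φ X) →
      2 * (∫ X in cellN N L, g X * φ X * ‖Θ.ψ X‖ ^ 2) -
        dirichletFormW L (fun X => ‖Θ.ψ X‖) φ φ ≤ C := by
    intro φ hφ hφsymm
    set a : ℝ := ∫ X in cellN N L, g X * φ X * ‖Θ.ψ X‖ ^ 2 with ha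
    set D : ℝ := dirichletFormW L (fun X => ‖Θ.ψ X‖) φ φ with hD
    set b : ℝ := ∫ X in cellN N L, g X * φ X ^ 2 * ‖Θ.ψ X‖ ^ 2 with hb
    set m₁ : ℝ := ∫ X in cellN N L, (1 : ℝ) * φ X * ‖Θ.ψ X‖ ^ 2 with hm₁
    set m₂ : ℝ := ∫ X in cellN N L, (1 : ℝ) * φ X ^ 2 * ‖Θ.ψ X‖ ^ 2 with hm₂
    -- integrability of the continuous densities on the cell
    have ig0 : IntegrableOn (fun X => g X * ‖Θ.ψ X‖ ^ 2) (cellN N L) :=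
      integrableOn_cellN (hgc.mul (hFc.pow 2)) L
    have ig1 : IntegrableOn (fun X => g X * φ X * ‖Θ.ψ X‖ ^ 2) (cellN N L) :=
      integrableOn_cellN ((hgc.mul hφ.continuous).mul (hFc.pow 2)) L
    have ig2 : IntegrableOn (fun X => g X * φ X ^ 2 * ‖Θ.ψ X‖ ^ 2) (cellN N L) :=
      integrableOn_cellN ((hgc.mul (hφ.continuous.pow 2)).mul (hFc.pow 2)) L
    have i10 : IntegrableOn (fun X => (1 : ℝ) * ‖Θ.ψ X‖ ^ 2) (cellN N L) :=
      integrableOn_cellN (continuous_const.mul (hFc.pow 2)) L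
    have i11 : IntegrableOn (fun X => (1 : ℝ) * φ X * ‖Θ.ψ X‖ ^ 2) (cellN N L) :=
      integrableOn_cellN ((continuous_const.mul hφ.continuous).mul (hFc.pow 2)) L
    have i12 : IntegrableOn (fun X => (1 : ℝ) * φ X ^ 2 * ‖Θ.ψ X‖ ^ 2) (cellN N L) :=
      integrableOn_cellN ((continuous_const.mul (hφ.continuous.pow 2)).mul (hFc.pow 2)) L
    have hnorm1 : ∫ X in cellN N L, (1 : ℝ) * ‖Θ.ψ X‖ ^ 2 = 1 := by
      simp only [one_mul]; exact integral_norm_sq_eq_one Θ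
    -- the admissible perturbed states `c_s (1 + sφ)Θ`
    obtain ⟨ε₀, hε₀, hpert⟩ := exists_perturbedState hreal hφ.1 hφ.2 hφsymm
    -- the key inequality for `0 < |s| < ε₀`
    have hineq : ∀ s : ℝ, |s| < ε₀ → s ≠ 0 →
        0 ≤ D - 2 * a - s * b + C * (1 + 2 * s * m₁ + s ^ 2 * m₂) := by
      intro s hs hs0
      obtain ⟨Ψ, c, hc, hΨ⟩ := hpert s hs
      obtain ⟨hne, -, hgΨ, hn⟩ := energy_perturbedState hW hEW hreal hfin s hφ.1 g Ψ hΨ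
      -- the ground-state representation of `Ψ = θΘ`, `θ = c(1 + sφ)`
      have hθ : ContDiff ℝ 1 fun X => c * (1 + s * φ X) :=
        contDiff_const.mul (contDiff_const.add (contDiff_const.mul hφ.1))
      have hθper : IsLatticePeriodic L fun X => c * (1 + s * φ X) := fun X i e => by
        show c * (1 + s * φ _) = c * (1 + s * φ X)
        rw [hφ.2 X i e]
      have hθsymm : ∀ (σ : Equiv.Perm (Fin N)) (X : Config N),
          (fun X => c * (1 + s * φ X)) (X ∘ σ) = (fun X => c * (1 + s * φ X)) X := fun σ X => by
        simp only [hφsymm σ X]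
      have hΨ' : ∀ X, Ψ.ψ X = (((fun X => c * (1 + s * φ X)) X * ‖Θ.ψ X‖ : ℝ) : ℂ) :=
        fun X => by rw [hΨ X]
      have hgs := gsRepresentation hW hEW hreal hfin hmin Ψ hθ hθper hθsymm hΨ'
      -- `𝓔_Θ(θ, θ) = c² s² D`
      have hθfun : (fun X => c * (1 + s * φ X)) = (c * s) • φ - fun _ => -c := by
        funext X; simp only [Pi.sub_apply, Pi.smul_apply, smul_eq_mul]; ring
      have hDθ : dirichletFormW L (fun X => ‖Θ.ψ X‖) (fun X => c * (1 + s * φ X))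
          (fun X => c * (1 + s * φ X)) = (c * s) ^ 2 * D := by
        rw [hθfun, dirichletFormW_sub_sub hFc (hφ.smul _) (IsPeriodicTest.const L _),
          dirichletFormW_const_right, dirichletFormW_const_left, dirichletFormW_smul_left,
          dirichletFormW_smul_right, ← hD]
        ring
      rw [hDθ] at hgs
      -- expansions of `∫ g ((1+sφ)Θ)²` and of the mass `∫ ((1+sφ)Θ)²`
      have hexp_g := integral_mul_perturb_sq s ig0 ig1 ig2
      rw [hmean, ← ha, ← hb] at hexp_g
      have hexp_1 := integral_mul_perturb_sq s i10 i11 i12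
      rw [hnorm1, ← hm₁, ← hm₂] at hexp_1
      simp only [one_mul] at hexp_1
      rw [hexp_1] at hn
      rw [hexp_g] at hgΨ
      -- the hypothesis at `(t, Ψ) = (-s, Ψ_s)`
      have hr := hresp (-s) Ψ hne
      rw [hE0r, hgs, hgΨ] at hr
      -- algebra: `-C s² ≤ c² s² (D - 2a - s b)`, times `n = 1/c² > 0`, divided by `s²`
      have h1 : -C * s ^ 2 ≤ c ^ 2 * s ^ 2 * (D - 2 * a - s * b) := by nlinarith [hr]
      have hnpos : 0 < 1 + 2 * s * m₁ + s ^ 2 * m₂ := by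
        by_contra hle
        rw [not_lt] at hle
        nlinarith [mul_nonneg (sq_nonneg c) (neg_nonneg.2 hle), hn]
      have h2 := mul_le_mul_of_nonneg_right h1 hnpos.le
      have e : c ^ 2 * s ^ 2 * (D - 2 * a - s * b) * (1 + 2 * s * m₁ + s ^ 2 * m₂) =
          s ^ 2 * (D - 2 * a - s * b) * (c ^ 2 * (1 + 2 * s * m₁ + s ^ 2 * m₂)) := by ring
      rw [e, hn, mul_one] at h2
      have h3 : 0 ≤ s ^ 2 * (D - 2 * a - s * b + C * (1 + 2 * s * m₁ + s ^ 2 * m₂)) := by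
        nlinarith [h2]
      exact (mul_nonneg_iff_of_pos_left (by positivity : (0 : ℝ) < s ^ 2)).1 h3
    -- let `s → 0` along `s ≠ 0`
    have hPc : Continuous fun s : ℝ => D - 2 * a - s * b + C * (1 + 2 * s * m₁ + s ^ 2 * m₂) := by
      fun_prop
    have htend : Tendsto (fun s : ℝ => D - 2 * a - s * b + C * (1 + 2 * s * m₁ + s ^ 2 * m₂))
        (𝓝[≠] 0) (𝓝 (D - 2 * a - 0 * b + C * (1 + 2 * 0 * m₁ + 0 ^ 2 * m₂))) :=
      (hPc.tendsto 0).mono_left nhdsWithin_le_nhds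
    have hev : ∀ᶠ s in 𝓝[≠] (0 : ℝ),
        0 ≤ D - 2 * a - s * b + C * (1 + 2 * s * m₁ + s ^ 2 * m₂) := by
      have h1 : ∀ᶠ s in 𝓝[≠] (0 : ℝ), s ≠ 0 := eventually_mem_nhdsWithin.mono fun s hs => hs
      have h2 : ∀ᶠ s in 𝓝[≠] (0 : ℝ), |s| < ε₀ := by
        have h : ∀ᶠ s in 𝓝 (0 : ℝ), |s| < ε₀ := by
          simpa only [sub_zero] using eventually_abs_sub_lt (0 : ℝ) hε₀
        exact h.filter_mono nhdsWithin_le_nhds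
      filter_upwards [h1, h2] with s hs1 hs2 using hineq s hs2 hs1
    have hlim := ge_of_tendsto htend hev
    simp only [zero_mul, mul_zero, sub_zero, add_zero, zero_pow two_ne_zero, mul_one] at hlim
    linarith
  -- all test functions, by Bose symmetrisation of the test function
  refine hMinusOneSqW_le_of_symmetric_tests L hgc hgsymm hFc hFsymm fun φ hφ hφsymm => ?_
  have h := hmainS φ hφ hφsymm
  have e1 : ∫ X in cellN N L, ‖Θ.ψ X‖ ^ 2 * (φ X * g X) =
      ∫ X in cellN N L, g X * φ X * ‖Θ.ψ X‖ ^ 2 := by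
    congr 1 with X; ring
  have e2 : ∫ X in cellN N L, ‖Θ.ψ X‖ ^ 2 * gradDot φ φ X =
      dirichletFormW L (fun X => ‖Θ.ψ X‖) φ φ := by
    unfold dirichletFormW
    congr 1 with X; ring
  rw [e1, e2]
  exact h

end Summit.AtomisticToContinuum.BoseEinsteinCondensation.Theorems

end
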